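import Summits.HubbardSuperconductivity.HubbardSuperconductivity.Theorems.AnisotropyChordTransferFibre3RowDNTerm

/-!
# Route `AnisotropyChord` / H0 rotor rung, row D (KT-2a) Stage-1b: the LOOP-MAJORANT KIT (pointwise lemmas)

Stage-1b of the row-D program (p1 g29 memo ROWD-DESIGN-g29 §5–§6; p1 g30 NOTES `### LOOP FAMILIES`).  The loop halves
`nLoopU`, `mLoopU`, `loop2U`, … of the row-D coefficients are torus sums `Σ_p Π_i R_ψᵢ(σᵢp + cᵢ)` of regular slot factors
(`RowD.tconv_loop_eq`); Stage 1 majorises them ANALYTICALLY by box atoms.  THIS FILE holds the pointwise ingredients: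
* ★ `norm_one_sub_exp_neg_le` — `‖1 − e^{−ix}‖ ≤ |x|` (from `1 − x²/2 ≤ cos x`);
* ★ `norm_wt_le` — the gradient weight at ANY torus momentum: `‖1 − conj(phase q ē)‖ ≤ θ·|rep(q)·e|` for `e ∈ E4`, and
  `(rep(q)·e)² ≤ |rep q|²` (`qdot_sq_le_nsq`);
* ★ `zone` — the ZONE CONSTANT: `θ²·|rep k|²·g(k) ≤ c_Z := π²/(4 − π²ν)` for `λ = νθ²`, `0 ≤ ν < 4/π²` (Jordan: `JordanEpsLower`);
  hence ★ `wt_gres_sq_le` — `(‖1 − conj(phase k ē)‖·g(k))² ≤ c_Z·g(k)`;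
* ★ `gres_le_gmax` — `g(k) ≤ 1/(2ε₁ − λ)` for `λ < 2ε₁` (so `θ²g ≤ 1/(2ê₁ − ν)`);
* torus-sum tools: ★ `sum_comp_affine` (`Σ_p F(σp + c) = Σ_p F(p)`, `σ = ±1`), ★ `sum_gres_sq_affine` (`= S₂`), `sum_gres_affine` (`= S₁`),
  and the abstract Cauchy–Schwarz forms ★ `sum_mul_le_sqrt` / ★ `sum_three_two_le` / `sum_two_wt_le` … used by `…RowDLoopSums`.
Prover seat `hubbard-h0-rotor-p1` g30 (route lead); helper for piece A = stmt-HubbardSuperconductivity-23918 of rung 19089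
(`--supports`, helper class).  Nothing here proves superconductivity in the Hubbard model; lemmas for ONE row of ONE conditional reduction;
the rotor TARGET as originally worded stays FALSE (g15 verdict).  Tree imports only; no sorry.
-/

set_option linter.dupNamespace false
set_option autoImplicit false

open scoped BigOperators

namespace Summit.HubbardSuperconductivity.HubbardSuperconductivity.Theorems.AnisotropyChord.Transfer.Fibre3

namespace RowD

open RowC L2.N1

/-! ## §1 The gradient weight -/

/-- `‖1 − e^{−ix}‖ ≤ |x|` (`‖1 − e^{−ix}‖² = 2(1 − cos x) ≤ x²`). [folklore] -/
theorem norm_one_sub_exp_neg_le (x : ℝ) :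
    ‖(1 : ℂ) - Complex.exp (-(Complex.I * (x : ℂ)))‖ ≤ |x| := by
  have hcos := Real.one_sub_sq_div_two_le_cos (x := x)
  have hre : ((1 : ℂ) - Complex.exp (-(Complex.I * (x : ℂ)))).re = 1 - Real.cos x := by
    rw [show -(Complex.I * (x : ℂ)) = ((-x : ℝ) : ℂ) * Complex.I by push_cast; ring, Complex.sub_re, Complex.one_re,
      Complex.exp_ofReal_mul_I_re, Real.cos_neg]
  have him : ((1 : ℂ) - Complex.exp (-(Complex.I * (x : ℂ)))).im = Real.sin x := by
    rw [show -(Complex.I * (x : ℂ)) = ((-x : ℝ) : ℂ) * Complex.I by push_cast; ring, Complex.sub_im, Complex.one_im,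
      Complex.exp_ofReal_mul_I_im, Real.sin_neg]; ring
  have hsq : ‖(1 : ℂ) - Complex.exp (-(Complex.I * (x : ℂ)))‖ ^ 2 ≤ |x| ^ 2 := by
    rw [Complex.sq_norm, Complex.normSq_apply, hre, him, sq_abs]
    nlinarith [Real.sin_sq_add_cos_sq x]
  calc ‖(1 : ℂ) - Complex.exp (-(Complex.I * (x : ℂ)))‖
      = Real.sqrt (‖(1 : ℂ) - Complex.exp (-(Complex.I * (x : ℂ)))‖ ^ 2) := (Real.sqrt_sq (norm_nonneg _)).symm
    _ ≤ Real.sqrt (|x| ^ 2) := Real.sqrt_le_sqrt hsq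
    _ = |x| := Real.sqrt_sq (abs_nonneg x)

variable (L : ℕ) [NeZero L]

/-- ★ the gradient weight at ANY torus momentum along `e ∈ E4`: `‖1 − conj(phase q ē)‖ ≤ θ·|rep(q)·e|`. [folklore] -/
theorem norm_wt_le (q : Tor L) {e : ℤ × ℤ} (_he : e ∈ E4) :
    ‖(1 : ℂ) - (starRingEnd ℂ) (phase L q (B1.toTor L e))‖
      ≤ (2 * Real.pi / L) * |((qdot (B1.rep L q) e : ℤ) : ℝ)| := by
  have hq : q = B1.toTor L (B1.rep L q) := (B1.toTor_rep L q).symm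
  conv_lhs => rw [hq]
  rw [conj_phase_toTor_E4 L (B1.rep L q) e]
  have h := norm_one_sub_exp_neg_le ((2 * Real.pi / L) * ((qdot (B1.rep L q) e : ℤ) : ℝ))
  have hθ : 0 ≤ (2 * Real.pi / L : ℝ) := by positivity
  calc ‖(1 : ℂ) - Complex.exp (-(Complex.I * ((2 * Real.pi / L : ℝ) : ℂ) * ((qdot (B1.rep L q) e : ℤ) : ℂ)))‖
      = ‖(1 : ℂ) - Complex.exp (-(Complex.I * (((2 * Real.pi / L) * ((qdot (B1.rep L q) e : ℤ) : ℝ) : ℝ) : ℂ)))‖ := by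
        push_cast; ring_nf
    _ ≤ |(2 * Real.pi / L) * ((qdot (B1.rep L q) e : ℤ) : ℝ)| := h
    _ = (2 * Real.pi / L) * |((qdot (B1.rep L q) e : ℤ) : ℝ)| := by rw [abs_mul, abs_of_nonneg hθ]

omit [NeZero L] in
/-- along a unit vector the component is at most the Euclidean norm: `(rep·e)² ≤ |rep|²`. [folklore] -/
theorem qdot_sq_le_nsq (m : ℤ × ℤ) {e : ℤ × ℤ} (he : e ∈ E4) :
    (((qdot m e : ℤ) : ℝ)) ^ 2 ≤ B1.nsq m := by
  unfold B1.nsq qdot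
  simp only [E4, List.mem_cons, List.not_mem_nil, or_false] at he
  rcases he with rfl | rfl | rfl | rfl <;> · push_cast; nlinarith [sq_nonneg ((m.1 : ℤ) : ℝ), sq_nonneg ((m.2 : ℤ) : ℝ)]

/-- ★ weight norm squared vs `θ²|rep q|²`. [folklore] -/
theorem norm_wt_sq_le (q : Tor L) {e : ℤ × ℤ} (he : e ∈ E4) :
    ‖(1 : ℂ) - (starRingEnd ℂ) (phase L q (B1.toTor L e))‖ ^ 2 ≤ (2 * Real.pi / L) ^ 2 * B1.nsq (B1.rep L q) := by
  have h := norm_wt_le L q he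
  have hθ : 0 ≤ (2 * Real.pi / L : ℝ) := by positivity
  calc ‖(1 : ℂ) - (starRingEnd ℂ) (phase L q (B1.toTor L e))‖ ^ 2
      ≤ ((2 * Real.pi / L) * |((qdot (B1.rep L q) e : ℤ) : ℝ)|) ^ 2 := pow_le_pow_left₀ (norm_nonneg _) h 2
    _ = (2 * Real.pi / L) ^ 2 * (((qdot (B1.rep L q) e : ℤ) : ℝ)) ^ 2 := by rw [mul_pow, sq_abs]
    _ ≤ (2 * Real.pi / L) ^ 2 * B1.nsq (B1.rep L q) := mul_le_mul_of_nonneg_left (qdot_sq_le_nsq (B1.rep L q) he) (sq_nonneg _)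

/-- the weight is bounded by `2`. [folklore] -/
theorem norm_wt_le_two (q e : Tor L) : ‖(1 : ℂ) - (starRingEnd ℂ) (phase L q e)‖ ≤ 2 := by
  calc ‖(1 : ℂ) - (starRingEnd ℂ) (phase L q e)‖ ≤ ‖(1 : ℂ)‖ + ‖(starRingEnd ℂ) (phase L q e)‖ := norm_sub_le _ _
    _ = 2 := by rw [norm_one, Complex.norm_conj, norm_phase]; norm_num

/-! ## §2 The zone constant -/

/-- the zone constant `c_Z(ν) = π²/(4 − π²ν)`. -/
noncomputable def cZ (ν : ℝ) : ℝ := Real.pi ^ 2 / (4 - Real.pi ^ 2 * ν)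

/-- `c_Z > 0` for `ν < 4/π²`. [folklore] -/
theorem cZ_pos {ν : ℝ} (hν : ν < 4 / Real.pi ^ 2) : 0 < cZ ν := by
  have hπ := Real.pi_pos
  have h4 : Real.pi ^ 2 * ν < 4 := by rwa [lt_div_iff₀ (by positivity), mul_comm] at hν
  unfold cZ; exact div_pos (by positivity) (by linarith)

/-- ★ THE ZONE LEMMA: `θ²·|rep k|²·g(k) ≤ c_Z(ν)` (`λ = νθ²`, `0 ≤ ν < 4/π²`; Jordan's `ε(k) ≥ (2/π²)θ²|rep k|²`). [folklore] -/
theorem zone (ν : ℝ) (hν0 : 0 ≤ ν) (hν : ν < 4 / Real.pi ^ 2) (k : Tor L) :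
    (2 * Real.pi / L) ^ 2 * B1.nsq (B1.rep L k) * gres L (ν * (2 * Real.pi / L) ^ 2) k ≤ cZ ν := by
  have hπ := Real.pi_pos
  have hcZ := cZ_pos hν
  have h4 : Real.pi ^ 2 * ν < 4 := by rwa [lt_div_iff₀ (by positivity), mul_comm] at hν
  unfold gres
  split_ifs with hk
  · rw [mul_zero]; exact hcZ.le
  · have hj := RateLemma.jordanEpsLower_holds L k
    have hs : (1 : ℝ) ≤ B1.nsq (B1.rep L k) := by
      have := one_le_sq_add_sq _ _ (B1.rep_ne_zero L hk)
      unfold B1.nsq B1.rep; exact_mod_cast this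
    have hLpos : (0 : ℝ) < L := by exact_mod_cast Nat.pos_of_ne_zero (NeZero.ne L)
    set t : ℝ := (2 * Real.pi / L) ^ 2 with ht
    have htpos : 0 < t := by positivity
    set N : ℝ := B1.nsq (B1.rep L k) with hN
    have hj' : 2 / Real.pi ^ 2 * t * N ≤ epsT L k := by rw [hN]; unfold B1.nsq B1.rep; exact hj
    -- denominator: `2ε − νt ≥ t(4N/π² − ν) > 0`
    have hden : t * (4 * N / Real.pi ^ 2 - ν) ≤ 2 * epsT L k - ν * t := by
      have : t * (4 * N / Real.pi ^ 2 - ν) = 2 * (2 / Real.pi ^ 2 * t * N) - ν * t := by ring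
      rw [this]; linarith
    have hpos : 0 < 4 * N / Real.pi ^ 2 - ν := by
      have : 4 / Real.pi ^ 2 ≤ 4 * N / Real.pi ^ 2 := by
        rw [div_le_div_iff_of_pos_right (by positivity)]; linarith
      linarith
    have hden0 : 0 < 2 * epsT L k - ν * t := lt_of_lt_of_le (mul_pos htpos hpos) hden
    rw [mul_one_div, div_le_iff₀ hden0]
    -- `tN ≤ c_Z·(2ε − νt)` follows from `tN ≤ c_Z·t(4N/π² − ν)`, i.e. `N(4 − π²ν) ≤ π²(4N/π² − ν)` ⟸ `N ≥ 1`
    have key : t * N ≤ cZ ν * (t * (4 * N / Real.pi ^ 2 - ν)) := by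
      unfold cZ
      rw [div_mul_eq_mul_div, le_div_iff₀ (by linarith)]
      have : Real.pi ^ 2 * (t * (4 * N / Real.pi ^ 2 - ν)) = t * (4 * N - Real.pi ^ 2 * ν) := by field_simp
      rw [this]
      have hprod : 0 ≤ t * (N - 1) * (Real.pi ^ 2 * ν) := by
        have : 0 ≤ N - 1 := by linarith
        positivity
      nlinarith [hprod]
    exact key.trans (mul_le_mul_of_nonneg_left hden hcZ.le)

/-- ★ the weighted slot factor: `(‖1 − conj(phase k ē)‖·g(k))² ≤ c_Z(ν)·g(k)` (`e ∈ E4`). [folklore] -/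
theorem wt_gres_sq_le (ν : ℝ) (hν0 : 0 ≤ ν) (hν : ν < 4 / Real.pi ^ 2) (k : Tor L) {e : ℤ × ℤ} (he : e ∈ E4) :
    (‖(1 : ℂ) - (starRingEnd ℂ) (phase L k (B1.toTor L e))‖ * gres L (ν * (2 * Real.pi / L) ^ 2) k) ^ 2
      ≤ cZ ν * gres L (ν * (2 * Real.pi / L) ^ 2) k := by
  have hg := B1.gres_nonneg L ν hν k
  have hw := norm_wt_sq_le L k he
  have hz := zone L ν hν0 hν k
  calc (‖(1 : ℂ) - (starRingEnd ℂ) (phase L k (B1.toTor L e))‖ * gres L (ν * (2 * Real.pi / L) ^ 2) k) ^ 2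
      = ‖(1 : ℂ) - (starRingEnd ℂ) (phase L k (B1.toTor L e))‖ ^ 2 * gres L (ν * (2 * Real.pi / L) ^ 2) k
          * gres L (ν * (2 * Real.pi / L) ^ 2) k := by ring
    _ ≤ ((2 * Real.pi / L) ^ 2 * B1.nsq (B1.rep L k)) * gres L (ν * (2 * Real.pi / L) ^ 2) k
          * gres L (ν * (2 * Real.pi / L) ^ 2) k := by gcongr
    _ = ((2 * Real.pi / L) ^ 2 * B1.nsq (B1.rep L k) * gres L (ν * (2 * Real.pi / L) ^ 2) k)
          * gres L (ν * (2 * Real.pi / L) ^ 2) k := by ring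
    _ ≤ cZ ν * gres L (ν * (2 * Real.pi / L) ^ 2) k := mul_le_mul_of_nonneg_right hz hg

/-! ## §3 The propagator maximum -/

/-- ★ `g(k) ≤ 1/(2ε₁ − λ)` for `λ < 2ε₁` (`ε(k) ≥ ε₁` off the origin; `g(0) = 0`). [folklore] -/
theorem gres_le_gmax (hL : 2 ≤ L) {lam2 : ℝ} (hlam : lam2 < 2 * eps1 L) (k : Tor L) :
    gres L lam2 k ≤ 1 / (2 * eps1 L - lam2) := by
  have hpos : 0 < 2 * eps1 L - lam2 := by linarith
  unfold gres
  split_ifs with hk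
  · positivity
  · have hε := eps1_le_epsT L hL hk
    exact one_div_le_one_div_of_le hpos (by linarith)

/-! ## §4 Torus sums under affine reparametrisation -/

/-- `p ↦ σp + c` with `σ = ±1` (encoded by a `Bool`: `false ↦ +`, `true ↦ −`). -/
def affine (σ : Bool) (c p : Tor L) : Tor L := if σ then c - p else c + p

/-- ★ `Σ_p F(σp + c) = Σ_p F(p)`. [folklore] -/
theorem sum_comp_affine {M : Type*} [AddCommMonoid M] (F : Tor L → M) (σ : Bool) (c : Tor L) :
    ∑ p : Tor L, F (affine L σ c p) = ∑ p : Tor L, F p := by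
  unfold affine
  cases σ
  · simp only [Bool.false_eq_true, if_false]
    exact Fintype.sum_equiv (Equiv.addLeft c) (fun p => F (c + p)) F (fun p => rfl)
  · simp only [if_true]
    exact Fintype.sum_equiv (Equiv.subLeft c) (fun p => F (c - p)) F (fun p => rfl)

/-- ★ `Σ_p g(σp + c)² = S₂`. [folklore] -/
theorem sum_gres_sq_affine (lam2 : ℝ) (σ : Bool) (c : Tor L) :
    ∑ p : Tor L, gres L lam2 (affine L σ c p) ^ 2 = S2n L lam2 := by
  rw [S2n_eq]; exact sum_comp_affine L (fun q => gres L lam2 q ^ 2) σ c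

/-- ★ `Σ_p g(σp + c) = S₁`. [folklore] -/
theorem sum_gres_affine (lam2 : ℝ) (σ : Bool) (c : Tor L) :
    ∑ p : Tor L, gres L lam2 (affine L σ c p) = S1n L lam2 := by
  rw [S1n_eq]; exact sum_comp_affine L (fun q => gres L lam2 q) σ c

/-! ## §5 Abstract Cauchy–Schwarz forms (any finite index type) -/

section cs
variable {ι : Type*} [Fintype ι]

/-- `Σ u v ≤ √(Σ u²)·√(Σ v²)`. [folklore] -/
theorem sum_mul_le_sqrt (u v : ι → ℝ) :
    ∑ i, u i * v i ≤ Real.sqrt (∑ i, u i ^ 2) * Real.sqrt (∑ i, v i ^ 2) := by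
  have h := Finset.sum_mul_sq_le_sq_mul_sq Finset.univ u v
  have h1 : 0 ≤ ∑ i, u i ^ 2 := Finset.sum_nonneg fun i _ => sq_nonneg _
  have h2 : 0 ≤ ∑ i, v i ^ 2 := Finset.sum_nonneg fun i _ => sq_nonneg _
  rw [← Real.sqrt_mul h1]
  exact Real.le_sqrt_of_sq_le h

/-- two nonneg `g`'s with square sums `≤ S`: `Σ g₁ g₂ ≤ S`. [folklore] -/
theorem sum_two_le {g₁ g₂ : ι → ℝ} {S : ℝ} (hS : 0 ≤ S)
    (h1 : ∑ i, g₁ i ^ 2 ≤ S) (h2 : ∑ i, g₂ i ^ 2 ≤ S) : ∑ i, g₁ i * g₂ i ≤ S := by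
  calc ∑ i, g₁ i * g₂ i ≤ Real.sqrt (∑ i, g₁ i ^ 2) * Real.sqrt (∑ i, g₂ i ^ 2) := sum_mul_le_sqrt g₁ g₂
    _ ≤ Real.sqrt S * Real.sqrt S := by gcongr
    _ = S := Real.mul_self_sqrt hS

/-- ★ family `{G, GW, GW}`: `g₀, A₂ ≥ 0`, `Aᵢ² ≤ c·gᵢ`, all square sums `≤ S` ⟹ `Σ g₀A₁A₂ ≤ c·S`. [folklore] -/
theorem sum_three_two_le {g₀ g₁ g₂ A₁ A₂ : ι → ℝ} {c S : ℝ} (hc : 0 ≤ c) (hS : 0 ≤ S)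
    (hg₀ : ∀ i, 0 ≤ g₀ i) (hg₁ : ∀ i, 0 ≤ g₁ i) (hg₂ : ∀ i, 0 ≤ g₂ i) (hA₂ : ∀ i, 0 ≤ A₂ i)
    (hb₁ : ∀ i, A₁ i ^ 2 ≤ c * g₁ i) (hb₂ : ∀ i, A₂ i ^ 2 ≤ c * g₂ i)
    (h0 : ∑ i, g₀ i ^ 2 ≤ S) (h1 : ∑ i, g₁ i ^ 2 ≤ S) (h2 : ∑ i, g₂ i ^ 2 ≤ S) :
    ∑ i, g₀ i * A₁ i * A₂ i ≤ c * S := by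
  -- `A₁A₂ ≤ c √g₁ √g₂`
  have hA : ∀ i, A₁ i * A₂ i ≤ c * (Real.sqrt (g₁ i) * Real.sqrt (g₂ i)) := by
    intro i
    have e1 : A₁ i ≤ Real.sqrt (c * g₁ i) := Real.le_sqrt_of_sq_le (hb₁ i)
    have e2 : A₂ i ≤ Real.sqrt (c * g₂ i) := Real.le_sqrt_of_sq_le (hb₂ i)
    calc A₁ i * A₂ i ≤ Real.sqrt (c * g₁ i) * Real.sqrt (c * g₂ i) := mul_le_mul e1 e2 (hA₂ i) (Real.sqrt_nonneg _)
      _ = c * (Real.sqrt (g₁ i) * Real.sqrt (g₂ i)) := by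
          rw [Real.sqrt_mul hc, Real.sqrt_mul hc]
          linear_combination (Real.sqrt (g₁ i) * Real.sqrt (g₂ i)) * Real.mul_self_sqrt hc
  have step1 : ∑ i, g₀ i * A₁ i * A₂ i ≤ c * ∑ i, (Real.sqrt (g₀ i * g₁ i)) * (Real.sqrt (g₀ i * g₂ i)) := by
    rw [Finset.mul_sum]
    refine Finset.sum_le_sum fun i _ => ?_
    have := mul_le_mul_of_nonneg_left (hA i) (hg₀ i)
    calc g₀ i * A₁ i * A₂ i = g₀ i * (A₁ i * A₂ i) := by ring
      _ ≤ g₀ i * (c * (Real.sqrt (g₁ i) * Real.sqrt (g₂ i))) := this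
      _ = c * (Real.sqrt (g₀ i * g₁ i) * Real.sqrt (g₀ i * g₂ i)) := by
          rw [Real.sqrt_mul (hg₀ i), Real.sqrt_mul (hg₀ i)]
          have : Real.sqrt (g₀ i) * Real.sqrt (g₀ i) = g₀ i := Real.mul_self_sqrt (hg₀ i)
          calc g₀ i * (c * (Real.sqrt (g₁ i) * Real.sqrt (g₂ i)))
              = (Real.sqrt (g₀ i) * Real.sqrt (g₀ i)) * (c * (Real.sqrt (g₁ i) * Real.sqrt (g₂ i))) := by rw [this]
            _ = _ := by ring
  have step2 : ∑ i, (Real.sqrt (g₀ i * g₁ i)) * (Real.sqrt (g₀ i * g₂ i))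
      ≤ Real.sqrt (∑ i, g₀ i * g₁ i) * Real.sqrt (∑ i, g₀ i * g₂ i) := by
    have h := sum_mul_le_sqrt (fun i => Real.sqrt (g₀ i * g₁ i)) (fun i => Real.sqrt (g₀ i * g₂ i))
    simp only [Real.sq_sqrt (mul_nonneg (hg₀ _) (hg₁ _)), Real.sq_sqrt (mul_nonneg (hg₀ _) (hg₂ _))] at h
    exact h
  have t1 : ∑ i, g₀ i * g₁ i ≤ S := sum_two_le hS h0 h1
  have t2 : ∑ i, g₀ i * g₂ i ≤ S := sum_two_le hS h0 h2
  calc ∑ i, g₀ i * A₁ i * A₂ i ≤ c * ∑ i, (Real.sqrt (g₀ i * g₁ i)) * (Real.sqrt (g₀ i * g₂ i)) := step1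
    _ ≤ c * (Real.sqrt (∑ i, g₀ i * g₁ i) * Real.sqrt (∑ i, g₀ i * g₂ i)) := mul_le_mul_of_nonneg_left step2 hc
    _ ≤ c * (Real.sqrt S * Real.sqrt S) := by gcongr
    _ = c * S := by rw [Real.mul_self_sqrt hS]

/-- ★ family `{G, G, G}`: `Σ g₀g₁g₂ ≤ M·S` if `0 ≤ g₂ ≤ M`. [folklore] -/
theorem sum_three_zero_le {g₀ g₁ g₂ : ι → ℝ} {M S : ℝ} (hM : 0 ≤ M) (hS : 0 ≤ S)
    (hg₀ : ∀ i, 0 ≤ g₀ i) (hg₁ : ∀ i, 0 ≤ g₁ i) (hle : ∀ i, g₂ i ≤ M)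
    (h0 : ∑ i, g₀ i ^ 2 ≤ S) (h1 : ∑ i, g₁ i ^ 2 ≤ S) :
    ∑ i, g₀ i * g₁ i * g₂ i ≤ M * S := by
  calc ∑ i, g₀ i * g₁ i * g₂ i ≤ ∑ i, g₀ i * g₁ i * M :=
        Finset.sum_le_sum fun i _ => mul_le_mul_of_nonneg_left (hle i) (mul_nonneg (hg₀ i) (hg₁ i))
    _ = M * ∑ i, g₀ i * g₁ i := by rw [Finset.mul_sum]; exact Finset.sum_congr rfl fun i _ => by ring
    _ ≤ M * S := mul_le_mul_of_nonneg_left (sum_two_le hS h0 h1) hM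

/-- ★ family `{GW, GW}` (third factor constant): `Σ A₁A₂ ≤ c·S₁` if `Aᵢ² ≤ c gᵢ`, `Σ gᵢ ≤ S₁`. [folklore] -/
theorem sum_two_wt_le {g₁ g₂ A₁ A₂ : ι → ℝ} {c S₁ : ℝ} (hc : 0 ≤ c) (hS : 0 ≤ S₁)
    (hg₁ : ∀ i, 0 ≤ g₁ i) (hg₂ : ∀ i, 0 ≤ g₂ i) (hA₂ : ∀ i, 0 ≤ A₂ i)
    (hb₁ : ∀ i, A₁ i ^ 2 ≤ c * g₁ i) (hb₂ : ∀ i, A₂ i ^ 2 ≤ c * g₂ i)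
    (h1 : ∑ i, g₁ i ≤ S₁) (h2 : ∑ i, g₂ i ≤ S₁) :
    ∑ i, A₁ i * A₂ i ≤ c * S₁ := by
  have hA : ∀ i, A₁ i * A₂ i ≤ c * (Real.sqrt (g₁ i) * Real.sqrt (g₂ i)) := by
    intro i
    have e1 : A₁ i ≤ Real.sqrt (c * g₁ i) := Real.le_sqrt_of_sq_le (hb₁ i)
    have e2 : A₂ i ≤ Real.sqrt (c * g₂ i) := Real.le_sqrt_of_sq_le (hb₂ i)
    calc A₁ i * A₂ i ≤ Real.sqrt (c * g₁ i) * Real.sqrt (c * g₂ i) := mul_le_mul e1 e2 (hA₂ i) (Real.sqrt_nonneg _)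
      _ = c * (Real.sqrt (g₁ i) * Real.sqrt (g₂ i)) := by
          rw [Real.sqrt_mul hc, Real.sqrt_mul hc]
          linear_combination (Real.sqrt (g₁ i) * Real.sqrt (g₂ i)) * Real.mul_self_sqrt hc
  have hcs := sum_mul_le_sqrt (fun i => Real.sqrt (g₁ i)) (fun i => Real.sqrt (g₂ i))
  simp only [Real.sq_sqrt (hg₁ _), Real.sq_sqrt (hg₂ _)] at hcs
  calc ∑ i, A₁ i * A₂ i ≤ ∑ i, c * (Real.sqrt (g₁ i) * Real.sqrt (g₂ i)) := Finset.sum_le_sum fun i _ => hA i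
    _ = c * ∑ i, Real.sqrt (g₁ i) * Real.sqrt (g₂ i) := by rw [Finset.mul_sum]
    _ ≤ c * (Real.sqrt (∑ i, g₁ i) * Real.sqrt (∑ i, g₂ i)) := mul_le_mul_of_nonneg_left hcs hc
    _ ≤ c * (Real.sqrt S₁ * Real.sqrt S₁) := by gcongr
    _ = c * S₁ := by rw [Real.mul_self_sqrt hS]

/-- ★ family `{G, GW}` (third factor constant): `Σ g₁A₂ ≤ √(c·S·S₁)` if `A₂² ≤ c g₂`, `Σg₁² ≤ S`, `Σg₂² ≤ S`, `Σ g₁ ≤ S₁`. [folklore] -/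
theorem sum_one_wt_le {g₁ g₂ A₂ : ι → ℝ} {c S S₁ : ℝ} (hc : 0 ≤ c) (hS : 0 ≤ S)
    (hg₁ : ∀ i, 0 ≤ g₁ i) (hg₂ : ∀ i, 0 ≤ g₂ i) (hb₂ : ∀ i, A₂ i ^ 2 ≤ c * g₂ i)
    (h1 : ∑ i, g₁ i ^ 2 ≤ S) (h2 : ∑ i, g₂ i ^ 2 ≤ S) (h1' : ∑ i, g₁ i ≤ S₁) :
    ∑ i, g₁ i * A₂ i ≤ Real.sqrt (c * S * S₁) := by
  -- `g₁A₂ ≤ √c · √(g₁g₂) · √g₁`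
  have hpt : ∀ i, g₁ i * A₂ i ≤ Real.sqrt c * (Real.sqrt (g₁ i * g₂ i) * Real.sqrt (g₁ i)) := by
    intro i
    have e2 : A₂ i ≤ Real.sqrt (c * g₂ i) := Real.le_sqrt_of_sq_le (hb₂ i)
    calc g₁ i * A₂ i ≤ g₁ i * Real.sqrt (c * g₂ i) := mul_le_mul_of_nonneg_left e2 (hg₁ i)
      _ = Real.sqrt c * (Real.sqrt (g₁ i * g₂ i) * Real.sqrt (g₁ i)) := by
          rw [Real.sqrt_mul hc, Real.sqrt_mul (hg₁ i)]
          have : g₁ i = Real.sqrt (g₁ i) * Real.sqrt (g₁ i) := (Real.mul_self_sqrt (hg₁ i)).symm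
          conv_lhs => rw [this]
          ring
  have hcs := sum_mul_le_sqrt (fun i => Real.sqrt (g₁ i * g₂ i)) (fun i => Real.sqrt (g₁ i))
  simp only [Real.sq_sqrt (mul_nonneg (hg₁ _) (hg₂ _)), Real.sq_sqrt (hg₁ _)] at hcs
  have t : ∑ i, g₁ i * g₂ i ≤ S := sum_two_le hS h1 h2
  calc ∑ i, g₁ i * A₂ i ≤ ∑ i, Real.sqrt c * (Real.sqrt (g₁ i * g₂ i) * Real.sqrt (g₁ i)) :=
        Finset.sum_le_sum fun i _ => hpt i
    _ = Real.sqrt c * ∑ i, Real.sqrt (g₁ i * g₂ i) * Real.sqrt (g₁ i) := by rw [Finset.mul_sum]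
    _ ≤ Real.sqrt c * (Real.sqrt (∑ i, g₁ i * g₂ i) * Real.sqrt (∑ i, g₁ i)) :=
        mul_le_mul_of_nonneg_left hcs (Real.sqrt_nonneg _)
    _ ≤ Real.sqrt c * (Real.sqrt S * Real.sqrt S₁) := by gcongr
    _ = Real.sqrt (c * S * S₁) := by rw [Real.sqrt_mul (mul_nonneg hc hS), Real.sqrt_mul hc]; ring

/-- ★ family `{GW}` (two factors constant): `Σ A ≤ √(c·S₁·N)` if `A² ≤ c g`, `Σ g ≤ S₁`, `N = card`. [folklore] -/
theorem sum_wt_le {g A : ι → ℝ} {c S₁ : ℝ} (hc : 0 ≤ c) (hS₁ : 0 ≤ S₁)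
    (hg : ∀ i, 0 ≤ g i) (hb : ∀ i, A i ^ 2 ≤ c * g i) (h1 : ∑ i, g i ≤ S₁) :
    ∑ i, A i ≤ Real.sqrt (c * S₁ * (Fintype.card ι : ℝ)) := by
  have hpt : ∀ i, A i ≤ Real.sqrt c * Real.sqrt (g i) := by
    intro i
    calc A i ≤ Real.sqrt (c * g i) := Real.le_sqrt_of_sq_le (hb i)
      _ = Real.sqrt c * Real.sqrt (g i) := by rw [Real.sqrt_mul hc]
  have hcs := sum_mul_le_sqrt (fun i => Real.sqrt (g i)) (fun _ => (1 : ℝ))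
  simp only [Real.sq_sqrt (hg _), one_pow, Finset.sum_const, Finset.card_univ, nsmul_eq_mul, mul_one] at hcs
  calc ∑ i, A i ≤ ∑ i, Real.sqrt c * Real.sqrt (g i) := Finset.sum_le_sum fun i _ => hpt i
    _ = Real.sqrt c * ∑ i, Real.sqrt (g i) := by rw [Finset.mul_sum]
    _ ≤ Real.sqrt c * (Real.sqrt (∑ i, g i) * Real.sqrt (Fintype.card ι : ℝ)) :=
        mul_le_mul_of_nonneg_left hcs (Real.sqrt_nonneg _)
    _ ≤ Real.sqrt c * (Real.sqrt S₁ * Real.sqrt (Fintype.card ι : ℝ)) := by gcongr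
    _ = Real.sqrt (c * S₁ * (Fintype.card ι : ℝ)) := by
        rw [Real.sqrt_mul (mul_nonneg hc hS₁), Real.sqrt_mul hc]; ring

end cs

end RowD

end Summit.HubbardSuperconductivity.HubbardSuperconductivity.Theorems.AnisotropyChord.Transfer.Fibre3
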